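import Mathlib.NumberTheory.LegendreSymbol.AddCharacter
import Literature.Computability.MetaComplexity.AndProductSpanLowerBound
import Literature.Computability.Complexity.Circuit
import HarnessLib

/-!
# Barrier catalogue `QuantumAdvantage`: depth-two circuits with two moduli cannot compute `AND` in subexponential size (Barrington–Straubing–Thérien 1990; Krause–Pudlák 1997; Grolmusz–Tardos 2000) — the `d = 1` case of the Constant Degree Hypothesis

D-0021 barrier entry for the summit `QuantumAdvantage`, bearing on the shallow-circuit
sub-problem `AdviceFreeQNC0` (advice-free `QNC⁰ ⊄ AC⁰[p]`) and its rung ladder for odd primes: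
the dense cruxes of the routes `OddPrimeWalk` (`DenseResidualOdd`) and `DWalkThree`
(`RingDenseResidual3`) are games whose "labels-given" relaxations are lower bounds for
three-level circuits with two different moduli and polylogarithmic bottom fan-in
(`MOD₂ ∘ MOD_p ∘ AND_polylog`, resp. `MOD₃ ∘ MOD₂`-type stakes), i.e. statements of Constant-Degree-
Hypothesis type (planner files ROUND-13 §3♯, ROUND-15 §4.2 of the cell qa-qnc0, 2026-08-27).
This file records, AS A THEOREM, what print knows: the bottom-fan-in-`1` case.

**The printed results.**

* D. A. Mix Barrington, H. Straubing, D. Thérien, *Non-uniform automata over groups*, Inform.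
  and Comput. 89 (1990) 109–132 [BarringtonStraubingTherien1990]. §4, CONJECTURE (p. 118): "If `G`
  is solvable, any family of NUDFA programs over `G` calculating the AND function has exponential
  size." §6, **Theorem 7** (p. 124): "The AND function cannot be written as an `F`-linear
  combination of fewer than `(k/(k−1))ⁿ` of the functions `Q_w`" (`|F*| = k`,
  `Q_w(u) = Π w_i^{u_i}`). §7, Proposition (p. 125): "Any NUDFA over `G_F` calculating the AND
  function has length `2^{Ω(n)}`", and the theorem of §8 for every extension of a `p`-group by an
  abelian group (e.g. `S₃`; S₃ itself: Barrington 1985, quoted §6 p. 122).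
* The circuit restatement (Kawałek–Weiß 2023, p. 2, citing Grolmusz–Tardos 2000, Grolmusz 2001,
  Straubing–Thérien 2006): "any 2-level `MOD_m ∘ MOD_q` circuit computing `AND_n` requires size
  `2^{Ω(n)}` (where `m` is an integer and `q` is a prime … the `MOD_q` gate is the output gate)"
  [KawalekWeiss2023] [GrolmuszTardos2000] [KrausePudlak1997] [StraubingTherien2005].
* Status of the general hypothesis (an `AND_d` layer of constant fan-in `d` at the inputs):
  "it remains wide open in its general form for over 30 years"; "the case `d = 1` was confirmed in
  the very same paper the hypothesis was defined"; proved for symmetric circuits (Kawałek–Weiß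
  2023, Cor. 3) and when each `MOD_m` gate receives `o(n²/log n)` `AND`-wires (Grolmusz–Tardos)
  [KawalekWeiss2023, pp. 1–4].

**What this file adds (all PROVED; no named fact is left open).** The device class as an explicit
definition — `ModModCircuit m q n`: `s` bottom gates, gate `j` accepting iff the `ℤ/m`-linear form
`Σ_i a_{ji} x_i` of the input bits lies in an arbitrary residue set `A_j ⊆ ℤ/m` (this covers `MOD_m`
gates with constants, negated and repeated literals, and direct input wires to the top), and a top
gate accepting iff `Σ_j μ_j [gate j accepts] ∈ B` for arbitrary weights `μ_j ∈ ℤ/q` and `B ⊆ ℤ/q`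
(a generalized `MOD_q` gate) — and the exponential lower bound with explicit constants:
`modModCircuit_and_bound`: for `q` prime, `q ∤ m`, `m ≥ 1`, every such circuit computing `AND_n`
satisfies `mⁿ ≤ (s·m + 1)^{q−1} · (m − 1)ⁿ`, i.e. `s ≥ ((m/(m−1))^{n/(q−1)} − 1)/m = 2^{Ω(n)}`;
readings `modModCircuit_and_bound_two_three` (`MOD₃ ∘ MOD₂`, the `S₃` case: `2ⁿ ≤ (2s+1)²`) and
`modModCircuit_and_bound_three_two` (`MOD₂ ∘ MOD₃`: `3ⁿ ≤ (3s+1)·2ⁿ`); the catalogue decl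
`TwoModuliDepthTwo` (the bound, universally quantified) with `twoModuliDepthTwo_holds`.
`MOD_r` TARGETS (the bottom-fan-in-`1` case of the period theorem of Grolmusz–Tardos 2000 /
Straubing–Thérien 2006, as quoted by Kawałek–Weiß 2023 p. 3: "the only symmetric functions that
have representations as `MOD_m ∘ MOD_q` circuits of subexponential size must have periods of the
form `m·q^k`"), with explicit constants: `modModCircuit_modTest_bound` — for `gcd(m, r) = 1`,
`q ∤ r`, a circuit computing a non-constant residue test `[|x| mod r ∈ B]` on `n ≥ r − 1` inputs has
`m^{n−r+1} ≤ (s·m+1)^{q−1}·(m−1)^{n−r+1}`; readings `modModCircuit_modTest_bound_two_p_three`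
(`(q,m,r) = (2,p,3)`: a parity of `MOD_p` gates vs a `MOD₃` test — the test-oblivious exact form of
the cell's `VPE-lin` core, p2 ROUND-15 §3.7) and `modModCircuit_modTest_bound_two_three`. The
product-function core is `ProductSpan.InSpan.pow_le_card_mul_pow_modPeriodic` (the twisted
difference `γ(j+1) − λγ(j)` of a non-constant `r`-periodic `γ` stays non-constant when `λ^r ≠ 1` or
`λ = 1`; the values of `ψ` contain no `r`-th root of unity but `1` because `gcd(m, r) = 1`).
Mechanism (BST90 §6–7): over a field `L ⊇ 𝔽_q` containing the `m`-th roots of unity (Mathlib's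
`IsCyclotomicExtension.zeta` / `AddChar.zmodChar`), a bottom gate is an `L`-combination of the `m` product functions
`Q_{w(t)}`, `w(t)_i = ψ(t·a_{ji})`; the top gate is a polynomial of degree `q − 1` in their sum
(Fermat in `𝔽_q`); product functions multiply coordinatewise ("weight is submultiplicative"), so the
output is a combination of `≤ (sm+1)^{q−1}` product functions with entries in the `m` values of `ψ`,
and Theorem 7 (`Literature.Computability.MetaComplexity.ProductSpan`) forces
`mⁿ ≤ #·(m−1)ⁿ`.

## References

* [BarringtonStraubingTherien1990] §4 Conjecture (p. 118), §6 Thm. 7 (p. 124), §7 Prop. (p. 125)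
  (held: `lit read doi:10.1016/0890-5401(90)90007-5`).
* [KawalekWeiss2023] P. Kawałek, A. Weiß, arXiv:2311.17440, pp. 1–4, Cor. 3 (held).
* [GrolmuszTardos2000] SIAM J. Comput. 29(4) 1209–1222; [Grolmusz2001] DMTCS 4(2);
  [KrausePudlak1997] TCS 174; [StraubingTherien2005] Theory Comput. Syst. 39 (2006) 699–706 — the
  circuit forms, as cited by [KawalekWeiss2023] p. 2 (not held; cited for the statement only).
-/

noncomputable section

namespace Literature.Barriers.QuantumAdvantage

open Finset Literature.Computability.MetaComplexity.ProductSpan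
open Literature.Computability.Complexity

/-! ### The device class: generalized `MOD_q ∘ MOD_m` circuits -/

/-- **A depth-two circuit with a generalized `MOD_q` output gate over generalized `MOD_m` gates
of the input bits** (`n` inputs): `s` bottom gates; gate `j` accepts `x ∈ {0,1}ⁿ` iff the linear
form `Σ_i coef j i · x_i ∈ ℤ/m` lies in the residue set `acc j`; the output gate accepts iff
`Σ_j wt j · [gate j accepts] ∈ ℤ/q` lies in `top`. (Standard `MOD` gates: `acc`/`top` = the
non-zero residues; constants, negations, repeated wires and input wires into the top gate are all
instances.) [cite: BarringtonStraubingTherien1990, §7 (programs over G_F, p. 125)] -/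
structure ModModCircuit (m q n : ℕ) where
  /-- number of bottom gates (the size) -/
  s : ℕ
  /-- coefficients of the `ℤ/m`-linear form of bottom gate `j` -/
  coef : Fin s → Fin n → ZMod m
  /-- accepting residues of bottom gate `j` -/
  acc : Fin s → Finset (ZMod m)
  /-- weight of bottom gate `j` into the output gate -/
  wt : Fin s → ZMod q
  /-- accepting residues of the output gate -/
  top : Finset (ZMod q)

namespace ModModCircuit

variable {m q n : ℕ}

/-- The linear form of bottom gate `j` at input `x`. [cite: BarringtonStraubingTherien1990, §7 (p. 125)] -/
def linForm (C : ModModCircuit m q n) (j : Fin C.s) (x : Fin n → Bool) : ZMod m :=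
  ∑ i, if x i then C.coef j i else 0

/-- The value fed to the output gate. [cite: BarringtonStraubingTherien1990, §7 (p. 125)] -/
def topSum (C : ModModCircuit m q n) (x : Fin n → Bool) : ZMod q :=
  ∑ j, if C.linForm j x ∈ C.acc j then C.wt j else 0

/-- The Boolean function computed by the circuit. [cite: BarringtonStraubingTherien1990, §7 (p. 125)] -/
def eval (C : ModModCircuit m q n) (x : Fin n → Bool) : Bool :=
  decide (C.topSum x ∈ C.top)

/-- The circuit computes `AND_n` (accepts exactly the all-ones input). [cite: BarringtonStraubingTherien1990, §6 (the AND function, p. 124)] -/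
def ComputesAnd (C : ModModCircuit m q n) : Prop :=
  ∀ x, C.eval x = decide (∀ i, x i = true)

end ModModCircuit

/-! ### An additive character turns a `MOD_m` gate into `m` product functions -/

section Character

variable {m : ℕ} {L : Type*} [Field L] (ψ : AddChar (ZMod m) L)

/-- `ψ (Σ_i a_i) = Π_i ψ(a_i)`. [folklore] -/
private theorem map_finset_sum {ι : Type*} (T : Finset ι) (a : ι → ZMod m) :
    ψ (∑ i ∈ T, a i) = ∏ i ∈ T, ψ (a i) := by
  classical
  induction T using Finset.induction_on with
  | empty => simp
  | insert b T hb ih => rw [Finset.sum_insert hb, Finset.prod_insert hb, AddChar.map_add_eq_mul, ih]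

/-- The character of `t` times a linear form of bits is a product function:
`ψ(t · Σ_{i : x_i} a_i) = Q_w(x)` with `w_i = ψ(t a_i)`. [cite: BarringtonStraubingTherien1990, §7 (proof of the Proposition, p. 125)] -/
theorem char_linForm_eq_prodFn {n : ℕ} (a : Fin n → ZMod m) (t : ZMod m) (x : Fin n → Bool) :
    ψ (t * ∑ i, (if x i then a i else 0)) = prodFn (fun i => ψ (t * a i)) x := by
  rw [Finset.mul_sum, map_finset_sum]
  unfold prodFn
  refine Finset.prod_congr rfl fun i _ => ?_
  by_cases hx : x i
  · simp [hx]
  · simp [hx]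

/-- **Orthogonality**: for a PRIMITIVE `ψ` and `(m : L) ≠ 0`, the indicator of a residue is a
normalised character sum: `[b = 0] = m⁻¹ Σ_t ψ(t b)`. [cite: BarringtonStraubingTherien1990, §6 (orthogonality of the P_w, p. 123)] -/
theorem indicator_eq_char_sum [NeZero m] (hψ : ψ.IsPrimitive) (hmL : (m : L) ≠ 0) (b : ZMod m) :
    (if b = 0 then (1 : L) else 0) = (m : L)⁻¹ * ∑ t : ZMod m, ψ (t * b) := by
  rw [AddChar.sum_mulShift b hψ, ZMod.card m]
  split_ifs <;> simp [hmL]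

end Character

/-! ### The lower bound -/

section Bound

variable {m q n : ℕ}

/-- **Depth-two two-moduli circuits need exponential size for `AND`** (BST90 Thm. 7 + §7; the
circuit form of Krause–Pudlák / Grolmusz–Tardos, with explicit constants): for `q` prime,
`q ∤ m`, `m ≥ 1`, a generalized `MOD_q ∘ MOD_m` circuit with `s` bottom gates computing `AND_n`
satisfies `mⁿ ≤ (s·m + 1)^{q−1} · (m − 1)ⁿ`. [cite: BarringtonStraubingTherien1990, Theorem 7 and §7 Proposition] -/
theorem modModCircuit_and_bound [hq : Fact q.Prime] (hm : 0 < m) (hqm : ¬ q ∣ m)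
    (C : ModModCircuit m q n) (hC : C.ComputesAnd) :
    m ^ n ≤ (C.s * m + 1) ^ (q - 1) * (m - 1) ^ n := by
  classical
  haveI : NeZero m := ⟨hm.ne'⟩
  -- a primitive additive character of `ℤ/m` with values in the cyclotomic extension `L` of `𝔽_q`
  have hmq : ((m : ℕ) : ZMod q) ≠ 0 := by
    rw [Ne, ZMod.natCast_eq_zero_iff]
    exact hqm
  haveI : NeZero ((m : ℕ) : ZMod q) := ⟨hmq⟩
  let L := CyclotomicField m (ZMod q)
  have hζ := IsCyclotomicExtension.zeta_spec m (ZMod q) L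
  let ψ : AddChar (ZMod m) L := AddChar.zmodChar m hζ.pow_eq_one
  have hψ : ψ.IsPrimitive := AddChar.zmodChar_primitive_of_primitive_root m hζ
  let φ : ZMod q →+* L := algebraMap (ZMod q) L
  have hφ : Function.Injective φ := φ.injective
  have hmL : (m : L) ≠ 0 := by
    intro h
    apply hmq
    apply hφ
    rw [map_zero, map_natCast]
    exact h
  -- the admissible entries: the values of `ψ`
  let S : Finset L := univ.image fun t : ZMod m => ψ t
  have hScard : S.card ≤ m := Finset.card_image_le.trans (by rw [Finset.card_univ, ZMod.card])
  have hSmul : ∀ a ∈ S, ∀ b ∈ S, a * b ∈ S := by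
    intro a ha b hb
    obtain ⟨t, _, rfl⟩ := Finset.mem_image.1 ha
    obtain ⟨t', _, rfl⟩ := Finset.mem_image.1 hb
    rw [← AddChar.map_add_eq_mul]
    exact Finset.mem_image_of_mem _ (Finset.mem_univ _)
  have hS1 : (1 : L) ∈ S := by
    rw [← AddChar.map_zero_eq_one ψ]
    exact Finset.mem_image_of_mem _ (Finset.mem_univ _)
  -- the index vectors: `w (j,t)_i = ψ(t · coef j i)`, plus the all-ones vector
  let w : Fin C.s × ZMod m → Fin n → L := fun jt i => ψ (jt.2 * C.coef jt.1 i)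
  let W0 : Finset (Fin n → L) := univ.image w ∪ {fun _ => 1}
  have hW0card : W0.card ≤ C.s * m + 1 := by
    refine (Finset.card_union_le _ _).trans ?_
    rw [Finset.card_singleton]
    refine Nat.add_le_add_right (Finset.card_image_le.trans ?_) 1
    rw [Finset.card_univ, Fintype.card_prod, Fintype.card_fin, ZMod.card]
  have hW0S : ∀ v ∈ W0, ∀ i, v i ∈ S := by
    intro v hv i
    rcases Finset.mem_union.1 hv with hv | hv
    · obtain ⟨jt, _, rfl⟩ := Finset.mem_image.1 hv
      exact Finset.mem_image_of_mem _ (Finset.mem_univ _)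
    · rw [Finset.mem_singleton] at hv
      rw [hv]; exact hS1
  have hone : (fun _ : Fin n => (1 : L)) ∈ W0 :=
    Finset.mem_union_right _ (Finset.mem_singleton_self _)
  -- (A) each bottom gate, as an `L`-valued indicator, is in the span of `W0`
  have hgate : ∀ j : Fin C.s,
      InSpan W0 (fun x => if C.linForm j x ∈ C.acc j then (1 : L) else 0) := by
    intro j
    -- `[ℓ ∈ A] = Σ_{r ∈ A} [ℓ = r] = Σ_t (Σ_{r ∈ A} m⁻¹ ψ(−t r)) · Q_{w(j,t)}`
    have hrep : ∀ x, (if C.linForm j x ∈ C.acc j then (1 : L) else 0) =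
        ∑ t : ZMod m, (∑ r ∈ C.acc j, (m : L)⁻¹ * ψ (-(t * r))) * prodFn (w (j, t)) x := by
      intro x
      have h1 : (if C.linForm j x ∈ C.acc j then (1 : L) else 0) =
          ∑ r ∈ C.acc j, (if C.linForm j x - r = 0 then (1 : L) else 0) := by
        simp_rw [sub_eq_zero]
        rw [Finset.sum_ite_eq]
      have h2 : ∀ r, (if C.linForm j x - r = 0 then (1 : L) else 0) =
          ∑ t : ZMod m, (m : L)⁻¹ * ψ (-(t * r)) * prodFn (w (j, t)) x := by
        intro r
        have key : ∑ t : ZMod m, (m : L)⁻¹ * ψ (-(t * r)) * prodFn (w (j, t)) x =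
            (m : L)⁻¹ * ∑ t : ZMod m, ψ (t * (C.linForm j x - r)) := by
          rw [Finset.mul_sum]
          refine Finset.sum_congr rfl fun t _ => ?_
          rw [mul_sub, sub_eq_add_neg, AddChar.map_add_eq_mul,
            show C.linForm j x = ∑ i, (if x i then C.coef j i else 0) from rfl,
            char_linForm_eq_prodFn ψ]
          ring
        rw [key, ← indicator_eq_char_sum ψ hψ hmL]
      rw [h1, Finset.sum_congr rfl fun r _ => h2 r, Finset.sum_comm]
      refine Finset.sum_congr rfl fun t _ => ?_
      rw [Finset.sum_mul]
    have h := inSpan_image_of_eq_sum (univ : Finset (ZMod m))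
      (fun t => ∑ r ∈ C.acc j, (m : L)⁻¹ * ψ (-(t * r))) (fun t => w (j, t)) hrep
    refine h.mono fun v hv => ?_
    obtain ⟨t, _, rfl⟩ := Finset.mem_image.1 hv
    exact Finset.mem_union_left _ (Finset.mem_image_of_mem w (Finset.mem_univ (j, t)))
  -- (B) the value fed to the top gate, transported to `L`
  have htop : InSpan W0 (fun x => φ (C.topSum x)) := by
    have h := InSpan.sum (univ : Finset (Fin C.s))
      (f := fun j x => φ (C.wt j) * (if C.linForm j x ∈ C.acc j then (1 : L) else 0))
      fun j _ => (hgate j).smul (φ (C.wt j))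
    refine h.imp fun c hc => fun x => ?_
    have hcx := hc x
    beta_reduce at hcx
    rw [← hcx]
    beta_reduce
    unfold ModModCircuit.topSum
    rw [map_sum]
    refine Finset.sum_congr rfl fun j _ => ?_
    split_ifs <;> simp
  -- (C) the output, transported to `L`, is in the span of the `(q-1)`-fold products of `W0`
  have hout : InSpan (powSet W0 (q - 1)) (fun x => if C.topSum x ∈ C.top then (1 : L) else 0) := by
    -- Fermat in `𝔽_q`: `[z = b] = 1 − (z − b)^{q−1}`
    have fermat : ∀ z b : ZMod q, (if z = b then (1 : L) else 0) = 1 - (φ z - φ b) ^ (q - 1) := by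
      intro z b
      rw [← map_sub, ← map_pow]
      by_cases hzb : z = b
      · rw [if_pos hzb, hzb, sub_self, zero_pow (Nat.sub_ne_zero_of_lt hq.out.one_lt), map_zero,
          sub_zero]
      · rw [if_neg hzb, ZMod.pow_card_sub_one_eq_one (sub_ne_zero.2 hzb), map_one, sub_self]
    have hrep : ∀ x, (if C.topSum x ∈ C.top then (1 : L) else 0) =
        ∑ b ∈ C.top, (1 - (φ (C.topSum x) - φ b) ^ (q - 1)) := by
      intro x
      rw [← Finset.sum_ite_eq' C.top (C.topSum x) (fun _ => (1 : L))]
      refine Finset.sum_congr rfl fun b _ => ?_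
      rw [← fermat]
      simp only [eq_comm]
    have hconst : InSpan (powSet W0 (q - 1)) (fun _ : Fin n → Bool => (1 : L)) := by
      have h := inSpan_prodFn (one_mem_powSet hone (q - 1))
      refine h.imp fun c hc => fun x => ?_
      have hcx := hc x
      beta_reduce at hcx
      rw [← hcx]
      beta_reduce
      rw [prodFn_one]
    have hpow : ∀ b : ZMod q,
        InSpan (powSet W0 (q - 1)) (fun x => (φ (C.topSum x) - φ b) ^ (q - 1)) := by
      intro b
      have hlin : InSpan W0 (fun x => φ (C.topSum x) - φ b) := by
        have h1 : InSpan W0 (fun _ : Fin n → Bool => φ b) := by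
          have h := (inSpan_prodFn hone).smul (φ b)
          refine h.imp fun c hc => fun x => ?_
          have hcx := hc x
          beta_reduce at hcx
          rw [← hcx]
          beta_reduce
          rw [prodFn_one, mul_one]
        exact htop.sub h1
      exact hlin.pow (q - 1)
    have h := InSpan.sum C.top (f := fun b x => 1 - (φ (C.topSum x) - φ b) ^ (q - 1))
      fun b _ => hconst.sub (hpow b)
    refine h.imp fun c hc => fun x => ?_
    have hcx := hc x
    beta_reduce at hcx
    rw [← hcx]
    beta_reduce
    exact hrep x
  -- (D) the output is `AND_n`
  have hand : InSpan (powSet W0 (q - 1)) (andFn L n) := by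
    refine hout.imp fun c hc => fun x => ?_
    have hcx := hc x
    beta_reduce at hcx
    rw [← hcx]
    have hiff : C.topSum x ∈ C.top ↔ ∀ i, x i = true := by
      have hx := hC x
      unfold ModModCircuit.eval at hx
      simpa using hx
    unfold andFn
    by_cases hall : ∀ i, x i = true
    · rw [if_pos hall, if_pos (hiff.2 hall)]
    · rw [if_neg hall, if_neg fun h => hall (hiff.1 h)]
  -- (E) Theorem 7
  have h7 := InSpan.pow_le_card_mul_pow hScard (entries_powSet hSmul hS1 hW0S (q - 1)) hand
  refine h7.trans (Nat.mul_le_mul_right _ ((card_powSet_le W0 (q - 1)).trans ?_))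
  exact Nat.pow_le_pow_left hW0card _

/-- **`MOD₃ ∘ MOD₂` (the `S₃` case, Barrington 1985 / BST90 §6 p. 122): `2ⁿ ≤ (2s + 1)²`**, so a
`MOD₃`-of-parities circuit computing `AND_n` has `s ≥ (2^{n/2} − 1)/2` gates.
[cite: BarringtonStraubingTherien1990, §6 (S₃, p. 122) and Theorem 7] -/
theorem modModCircuit_and_bound_two_three (C : ModModCircuit 2 3 n) (hC : C.ComputesAnd) :
    2 ^ n ≤ (C.s * 2 + 1) ^ 2 := by
  haveI : Fact (Nat.Prime 3) := ⟨Nat.prime_three⟩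
  have h := modModCircuit_and_bound (q := 3) (by norm_num) (by norm_num) C hC
  simpa using h

/-- **`MOD₂ ∘ MOD₃`: `3ⁿ ≤ (3s + 1) · 2ⁿ`**, so a parity of `MOD₃` gates computing `AND_n` has
`s ≥ ((3/2)ⁿ − 1)/3` gates. [cite: BarringtonStraubingTherien1990, Theorem 7 and §7 Proposition] -/
theorem modModCircuit_and_bound_three_two (C : ModModCircuit 3 2 n) (hC : C.ComputesAnd) :
    3 ^ n ≤ (C.s * 3 + 1) * 2 ^ n := by
  haveI : Fact (Nat.Prime 2) := ⟨Nat.prime_two⟩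
  have h := modModCircuit_and_bound (q := 2) (by norm_num) (by norm_num) C hC
  simpa using h

end Bound

/-! ### `MOD_r` targets (the period theorem at bottom fan-in `1`, explicit) -/

section ModTarget

variable {m q n : ℕ}

/-- The circuit computes the residue test `[|x| mod r ∈ B]` (for a `MOD_r` gate: `B` = the
non-zero residues). [cite: BarringtonStraubingTherien1990, §8 (programs over extensions of p-groups by abelian groups)] -/
def ModModCircuit.ComputesModTest (C : ModModCircuit m q n) (r : ℕ) (B : Finset (ZMod r)) : Prop :=
  ∀ x, C.eval x = decide (((GateFn.numOnes x : ℕ) : ZMod r) ∈ B)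

/-- **Depth-two two-moduli circuits need exponential size for `MOD_r` tests** (the circuit form of
BST90 §8 / Krause–Pudlák 1997 / Grolmusz–Tardos 2000 at bottom fan-in `1`, explicit constants): for
`q` prime, `q ∤ m`, `m ≥ 1`, `gcd(m, r) = 1`, `q ∤ r`, a generalized `MOD_q ∘ MOD_m` circuit with `s`
bottom gates computing a NON-CONSTANT residue test `[|x| mod r ∈ B]` (`∅ ≠ B ≠ ℤ/r`) on `n ≥ r − 1`
inputs satisfies `m^{n−r+1} ≤ (s·m + 1)^{q−1} · (m − 1)^{n−r+1}`.
[cite: BarringtonStraubingTherien1990, Theorem 7 and §8] -/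
theorem modModCircuit_modTest_bound [hq : Fact q.Prime] (hm : 0 < m) (hqm : ¬ q ∣ m)
    {r : ℕ} [NeZero r] (hmr : Nat.Coprime m r) (hqr : ¬ q ∣ r)
    (C : ModModCircuit m q n) {B : Finset (ZMod r)} (hB : B.Nonempty) (hB' : B ≠ univ)
    (hC : C.ComputesModTest r B) (hn : r - 1 ≤ n) :
    m ^ (n - (r - 1)) ≤ (C.s * m + 1) ^ (q - 1) * (m - 1) ^ (n - (r - 1)) := by
  classical
  haveI : NeZero m := ⟨hm.ne'⟩
  -- a primitive additive character of `ℤ/m` with values in the cyclotomic extension `L` of `𝔽_q`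
  have hmq : ((m : ℕ) : ZMod q) ≠ 0 := by
    rw [Ne, ZMod.natCast_eq_zero_iff]
    exact hqm
  haveI : NeZero ((m : ℕ) : ZMod q) := ⟨hmq⟩
  let L := CyclotomicField m (ZMod q)
  have hζ := IsCyclotomicExtension.zeta_spec m (ZMod q) L
  let ψ : AddChar (ZMod m) L := AddChar.zmodChar m hζ.pow_eq_one
  have hψ : ψ.IsPrimitive := AddChar.zmodChar_primitive_of_primitive_root m hζ
  let φ : ZMod q →+* L := algebraMap (ZMod q) L
  have hφ : Function.Injective φ := φ.injective
  have hmL : (m : L) ≠ 0 := by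
    intro h
    apply hmq
    apply hφ
    rw [map_zero, map_natCast]
    exact h
  have hrq : ((r : ℕ) : ZMod q) ≠ 0 := by
    rw [Ne, ZMod.natCast_eq_zero_iff]
    exact hqr
  have hrL : (r : L) ≠ 0 := by
    intro h
    apply hrq
    apply hφ
    rw [map_zero, map_natCast]
    exact h
  -- the admissible entries: the values of `ψ`
  let S : Finset L := univ.image fun t : ZMod m => ψ t
  have hScard : S.card ≤ m := Finset.card_image_le.trans (by rw [Finset.card_univ, ZMod.card])
  have hSmul : ∀ a ∈ S, ∀ b ∈ S, a * b ∈ S := by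
    intro a ha b hb
    obtain ⟨t, _, rfl⟩ := Finset.mem_image.1 ha
    obtain ⟨t', _, rfl⟩ := Finset.mem_image.1 hb
    rw [← AddChar.map_add_eq_mul]
    exact Finset.mem_image_of_mem _ (Finset.mem_univ _)
  have hS1 : (1 : L) ∈ S := by
    rw [← AddChar.map_zero_eq_one ψ]
    exact Finset.mem_image_of_mem _ (Finset.mem_univ _)
  -- no `r`-th root of unity among the values of `ψ` except `1` (uses `gcd(m, r) = 1`)
  have hSroot : ∀ a ∈ S, a ^ r ≠ 1 ∨ a = 1 := by
    intro a ha
    obtain ⟨t, _, rfl⟩ := Finset.mem_image.1 ha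
    by_cases ht : t = 0
    · right
      rw [ht, AddChar.map_zero_eq_one]
    · left
      intro hpow
      apply ht
      have h1 : ψ ((r : ZMod m) * t) = 1 := by
        rw [← nsmul_eq_mul, AddChar.map_nsmul_eq_pow]
        exact hpow
      have h2 : (r : ZMod m) * t = 0 := by
        have happ : ψ ((r : ZMod m) * t) =
            (IsCyclotomicExtension.zeta m (ZMod q) L) ^ (((r : ZMod m) * t).val) :=
          AddChar.zmodChar_apply _ _
        rw [happ, hζ.pow_eq_one_iff_dvd] at h1
        rw [← ZMod.val_eq_zero]
        exact Nat.eq_zero_of_dvd_of_lt h1 (ZMod.val_lt _)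
      have hu : IsUnit (r : ZMod m) := by
        rw [ZMod.isUnit_iff_coprime]
        exact hmr.symm
      exact (hu.mul_right_eq_zero).1 h2
  -- the index vectors: `w (j,t)_i = ψ(t · coef j i)`, plus the all-ones vector
  let w : Fin C.s × ZMod m → Fin n → L := fun jt i => ψ (jt.2 * C.coef jt.1 i)
  let W0 : Finset (Fin n → L) := univ.image w ∪ {fun _ => 1}
  have hW0card : W0.card ≤ C.s * m + 1 := by
    refine (Finset.card_union_le _ _).trans ?_
    rw [Finset.card_singleton]
    refine Nat.add_le_add_right (Finset.card_image_le.trans ?_) 1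
    rw [Finset.card_univ, Fintype.card_prod, Fintype.card_fin, ZMod.card]
  have hW0S : ∀ v ∈ W0, ∀ i, v i ∈ S := by
    intro v hv i
    rcases Finset.mem_union.1 hv with hv | hv
    · obtain ⟨jt, _, rfl⟩ := Finset.mem_image.1 hv
      exact Finset.mem_image_of_mem _ (Finset.mem_univ _)
    · rw [Finset.mem_singleton] at hv
      rw [hv]; exact hS1
  have hone : (fun _ : Fin n => (1 : L)) ∈ W0 :=
    Finset.mem_union_right _ (Finset.mem_singleton_self _)
  -- (A) each bottom gate, as an `L`-valued indicator, is in the span of `W0`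
  have hgate : ∀ j : Fin C.s,
      InSpan W0 (fun x => if C.linForm j x ∈ C.acc j then (1 : L) else 0) := by
    intro j
    have hrep : ∀ x, (if C.linForm j x ∈ C.acc j then (1 : L) else 0) =
        ∑ t : ZMod m, (∑ r ∈ C.acc j, (m : L)⁻¹ * ψ (-(t * r))) * prodFn (w (j, t)) x := by
      intro x
      have h1 : (if C.linForm j x ∈ C.acc j then (1 : L) else 0) =
          ∑ r ∈ C.acc j, (if C.linForm j x - r = 0 then (1 : L) else 0) := by
        simp_rw [sub_eq_zero]
        rw [Finset.sum_ite_eq]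
      have h2 : ∀ r, (if C.linForm j x - r = 0 then (1 : L) else 0) =
          ∑ t : ZMod m, (m : L)⁻¹ * ψ (-(t * r)) * prodFn (w (j, t)) x := by
        intro r
        have key : ∑ t : ZMod m, (m : L)⁻¹ * ψ (-(t * r)) * prodFn (w (j, t)) x =
            (m : L)⁻¹ * ∑ t : ZMod m, ψ (t * (C.linForm j x - r)) := by
          rw [Finset.mul_sum]
          refine Finset.sum_congr rfl fun t _ => ?_
          rw [mul_sub, sub_eq_add_neg, AddChar.map_add_eq_mul,
            show C.linForm j x = ∑ i, (if x i then C.coef j i else 0) from rfl,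
            char_linForm_eq_prodFn ψ]
          ring
        rw [key, ← indicator_eq_char_sum ψ hψ hmL]
      rw [h1, Finset.sum_congr rfl fun r _ => h2 r, Finset.sum_comm]
      refine Finset.sum_congr rfl fun t _ => ?_
      rw [Finset.sum_mul]
    have h := inSpan_image_of_eq_sum (univ : Finset (ZMod m))
      (fun t => ∑ r ∈ C.acc j, (m : L)⁻¹ * ψ (-(t * r))) (fun t => w (j, t)) hrep
    refine h.mono fun v hv => ?_
    obtain ⟨t, _, rfl⟩ := Finset.mem_image.1 hv
    exact Finset.mem_union_left _ (Finset.mem_image_of_mem w (Finset.mem_univ (j, t)))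
  -- (B) the value fed to the top gate, transported to `L`
  have htop : InSpan W0 (fun x => φ (C.topSum x)) := by
    have h := InSpan.sum (univ : Finset (Fin C.s))
      (f := fun j x => φ (C.wt j) * (if C.linForm j x ∈ C.acc j then (1 : L) else 0))
      fun j _ => (hgate j).smul (φ (C.wt j))
    refine h.imp fun c hc => fun x => ?_
    have hcx := hc x
    beta_reduce at hcx
    rw [← hcx]
    beta_reduce
    unfold ModModCircuit.topSum
    rw [map_sum]
    refine Finset.sum_congr rfl fun j _ => ?_
    split_ifs <;> simp
  -- (C) the output, transported to `L`, is in the span of the `(q-1)`-fold products of `W0`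
  have hout : InSpan (powSet W0 (q - 1)) (fun x => if C.topSum x ∈ C.top then (1 : L) else 0) := by
    have fermat : ∀ z b : ZMod q, (if z = b then (1 : L) else 0) = 1 - (φ z - φ b) ^ (q - 1) := by
      intro z b
      rw [← map_sub, ← map_pow]
      by_cases hzb : z = b
      · rw [if_pos hzb, hzb, sub_self, zero_pow (Nat.sub_ne_zero_of_lt hq.out.one_lt), map_zero,
          sub_zero]
      · rw [if_neg hzb, ZMod.pow_card_sub_one_eq_one (sub_ne_zero.2 hzb), map_one, sub_self]
    have hrep : ∀ x, (if C.topSum x ∈ C.top then (1 : L) else 0) =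
        ∑ b ∈ C.top, (1 - (φ (C.topSum x) - φ b) ^ (q - 1)) := by
      intro x
      rw [← Finset.sum_ite_eq' C.top (C.topSum x) (fun _ => (1 : L))]
      refine Finset.sum_congr rfl fun b _ => ?_
      rw [← fermat]
      simp only [eq_comm]
    have hconst : InSpan (powSet W0 (q - 1)) (fun _ : Fin n → Bool => (1 : L)) := by
      have h := inSpan_prodFn (one_mem_powSet hone (q - 1))
      refine h.imp fun c hc => fun x => ?_
      have hcx := hc x
      beta_reduce at hcx
      rw [← hcx]
      beta_reduce
      rw [prodFn_one]
    have hpow : ∀ b : ZMod q,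
        InSpan (powSet W0 (q - 1)) (fun x => (φ (C.topSum x) - φ b) ^ (q - 1)) := by
      intro b
      have hlin : InSpan W0 (fun x => φ (C.topSum x) - φ b) := by
        have h1 : InSpan W0 (fun _ : Fin n → Bool => φ b) := by
          have h := (inSpan_prodFn hone).smul (φ b)
          refine h.imp fun c hc => fun x => ?_
          have hcx := hc x
          beta_reduce at hcx
          rw [← hcx]
          beta_reduce
          rw [prodFn_one, mul_one]
        exact htop.sub h1
      exact hlin.pow (q - 1)
    have h := InSpan.sum C.top (f := fun b x => 1 - (φ (C.topSum x) - φ b) ^ (q - 1))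
      fun b _ => hconst.sub (hpow b)
    refine h.imp fun c hc => fun x => ?_
    have hcx := hc x
    beta_reduce at hcx
    rw [← hcx]
    beta_reduce
    exact hrep x
  -- (D) the output is the residue test `γ(|x| mod r)` with `γ = 1_B`, a non-constant `γ`
  set γ : ZMod r → L := fun j => if j ∈ B then 1 else 0 with hγ
  have hγnc : ∃ a b, γ a ≠ γ b := by
    obtain ⟨a, ha⟩ := hB
    obtain ⟨b, hb⟩ : ∃ b, b ∉ B := by
      by_contra hall
      push Not at hall
      exact hB' (Finset.eq_univ_of_forall hall)
    refine ⟨a, b, ?_⟩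
    rw [hγ]
    beta_reduce
    rw [if_pos ha, if_neg hb]
    exact one_ne_zero
  have htest : InSpan (powSet W0 (q - 1))
      (fun x => γ ((univ.filter fun i => x i = true).card : ℕ)) := by
    refine hout.imp fun c hc => fun x => ?_
    have hcx := hc x
    beta_reduce at hcx
    rw [← hcx]
    have hiff : C.topSum x ∈ C.top ↔ ((GateFn.numOnes x : ℕ) : ZMod r) ∈ B := by
      have hx := hC x
      unfold ModModCircuit.eval at hx
      simpa using hx
    have hwt : GateFn.numOnes x = (univ.filter fun i => x i = true).card := rfl
    rw [hγ]
    beta_reduce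
    rw [← hwt]
    by_cases hmem : ((GateFn.numOnes x : ℕ) : ZMod r) ∈ B
    · rw [if_pos hmem, if_pos (hiff.2 hmem)]
    · rw [if_neg hmem, if_neg fun h => hmem (hiff.1 h)]
  -- (E) the `MOD_r` form of Theorem 7
  have h7 := InSpan.pow_le_card_mul_pow_modPeriodic hrL hScard
    (fun a ha => hSroot a ha) (entries_powSet hSmul hS1 hW0S (q - 1)) hγnc htest hn
  refine h7.trans (Nat.mul_le_mul_right _ ((card_powSet_le W0 (q - 1)).trans ?_))
  exact Nat.pow_le_pow_left hW0card _

/-- **Reading for the cell's `VPE-lin` core (`OddPrimeWalk`, p2 ROUND-15 §3.7/§4): a parity of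
`MOD_p`-gates of linear forms (`p` an odd prime `≠ 3`) cannot even COMPUTE a `MOD₃` residue test
exactly unless `p^{n−2} ≤ (s·p + 1) · (p − 1)^{n−2}`**, i.e. `s ≥ ((p/(p−1))^{n−2} − 1)/p`
(`(q, m, r) = (2, p, 3)`). [cite: BarringtonStraubingTherien1990, Theorem 7 and §8] -/
theorem modModCircuit_modTest_bound_two_p_three {p : ℕ} (hp : p.Prime) (hp2 : p ≠ 2) (hp3 : p ≠ 3)
    (C : ModModCircuit p 2 n) {B : Finset (ZMod 3)} (hB : B.Nonempty) (hB' : B ≠ univ)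
    (hC : C.ComputesModTest 3 B) (hn : 2 ≤ n) :
    p ^ (n - 2) ≤ (C.s * p + 1) * (p - 1) ^ (n - 2) := by
  haveI : Fact (Nat.Prime 2) := ⟨Nat.prime_two⟩
  have h2p : ¬ 2 ∣ p := by
    intro h
    exact hp2 ((Nat.prime_dvd_prime_iff_eq Nat.prime_two hp).1 h).symm
  have hp3' : Nat.Coprime p 3 := by
    rw [Nat.coprime_comm, Nat.Prime.coprime_iff_not_dvd Nat.prime_three]
    intro h
    exact hp3 ((Nat.prime_dvd_prime_iff_eq Nat.prime_three hp).1 h).symm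
  have h := modModCircuit_modTest_bound (q := 2) (r := 3) hp.pos h2p hp3' (by norm_num) C hB hB' hC
    (by simpa using hn)
  simpa using h

/-- **Reading `MOD₃ ∘ MOD₂` vs `MOD_r`** (the `S₃` case): a `MOD₃`-of-parities circuit computing a
non-constant `MOD_r` residue test with `r` odd and `3 ∤ r` (e.g. `MOD₅`) has `2^{n−r+1} ≤ (2s+1)²`.
[cite: BarringtonStraubingTherien1990, §6 (S₃) and §8] -/
theorem modModCircuit_modTest_bound_two_three {r : ℕ} [NeZero r] (hr2 : Nat.Coprime 2 r)
    (hr3 : ¬ 3 ∣ r) (C : ModModCircuit 2 3 n) {B : Finset (ZMod r)} (hB : B.Nonempty)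
    (hB' : B ≠ univ) (hC : C.ComputesModTest r B) (hn : r - 1 ≤ n) :
    2 ^ (n - (r - 1)) ≤ (C.s * 2 + 1) ^ 2 := by
  haveI : Fact (Nat.Prime 3) := ⟨Nat.prime_three⟩
  have h := modModCircuit_modTest_bound (q := 3) (by norm_num) (by norm_num) hr2 hr3 C hB hB' hC hn
  simpa using h

end ModTarget

/-! ### The barrier -/

/-- **Depth-two circuits with two moduli need size `2^{Ω(n)}` for `AND_n`** (the catalogue decl:
Barrington–Straubing–Thérien's bound — the printed `d = 1` case of the Constant Degree Hypothesis —
in the explicit circuit form of `modModCircuit_and_bound`; PROVED below, `twoModuliDepthTwo_holds`).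

BARRIER
technique_class: [method families this entry bears on — tokens for the tribunal t4 match: two-moduli `MOD_q ∘ MOD_m` circuits / programs over `S₃`, `A₄`; constant-degree hypothesis (CDH); the polynomial method à la Razborov–Smolensky (Smolensky agreement bounds for low-degree `𝔽_p`-polynomials), fibre-elimination, Kilian random-self-reduction + Smolensky transport — each ONLY when applied test-obliviously, see the end of this line] representing the conjunction `AND_n` (equivalently, by fixing inputs, any function having `AND_n`/`OR_n` as a subfunction) EXACTLY, on every input, by a depth-TWO circuit with a (generalized) `MOD_q` output gate, `q` prime, over (generalized) `MOD_m` gates of the input literals with `q ∤ m` — `ModModCircuit m q n` above; equivalently polynomial-length programs (NUDFAs) over a group that is an extension of a `p`-group by an abelian group, e.g. `S₃` [cite: BarringtonStraubingTherien1990, §7–§8]; in the advice-free `QNC⁰` cell: any dense-case argument for the odd-prime u-walk / D-walk games that is oblivious to the PRESCRIBED `MOD₃` tests (uses only "a parity of 0/1-valued `𝔽_p`-low-degree tests", bottom fan-in read as `1`). METHOD-FAMILY READING: a Razborov–Smolensky / fibre-elimination / Kilian+Smolensky argument that is test-oblivious in the above sense is, read at bottom fan-in `1`, a statement inside this theorem's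 device class, and at polylog bottom fan-in it is evasion (1) below (open); arguments that USE the prescribed tests (relational / average-case, walk-specific structure) are OUTSIDE the technique class
blocks: subexponential-size `MOD_q ∘ MOD_m` circuits (bottom fan-in `1`, two levels) computing `AND_n`: `mⁿ ≤ (s·m+1)^{q−1}·(m−1)ⁿ`, i.e. `s ≥ ((m/(m−1))^{n/(q−1)} − 1)/m` (`modModCircuit_and_bound`; `MOD₃∘MOD₂`: `2ⁿ ≤ (2s+1)²`, `MOD₂∘MOD₃`: `3ⁿ ≤ (3s+1)·2ⁿ`) [cite: BarringtonStraubingTherien1990, Theorem 7 and §7 Proposition] [cite: KawalekWeiss2023, p. 2 (circuit restatement, citing Grolmusz–Tardos 2000, Grolmusz 2001, Straubing–Thérien 2006)] ALSO (same device class, `gcd(m, r) = 1`, `q ∤ r`, `n ≥ r − 1`): computing ANY non-constant `MOD_r` residue test `[|x| mod r ∈ B]` needs `m^{n−r+1} ≤ (s·m+1)^{q−1}·(m−1)^{n−r+1}` (`modModCircuit_modTest_bound`; reading `(q,m,r) = (2,p,3)`: a PARITY of `MOD_p` gates of linear forms, `p ≥ 5` prime, agreeing everywhere with a `MOD₃`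 residue test has `p^{n−2} ≤ (s·p+1)·(p−1)^{n−2}` — `modModCircuit_modTest_bound_two_p_three`; `MOD₃∘MOD₂` vs `MOD_r`, `r` odd, `3 ∤ r`: `2^{n−r+1} ≤ (2s+1)²`) [cite: KawalekWeiss2023, p. 3 (period theorem of Grolmusz–Tardos 2000 / Straubing–Thérien 2006: subexponential MOD_m∘MOD_q circuits compute only symmetric functions with periods m·q^k)]
because: over a field `L ⊇ 𝔽_q` containing the `m`-th roots of unity a `MOD_m` gate of a linear form is an `L`-combination of `m` product functions `Q_w(u) = Π w_i^{u_i}` with entries `m`-th roots of unity, the `MOD_q` output gate is a polynomial of degree `q − 1` in the gate values (Fermat), product functions multiply coordinatewise so the output uses `≤ (sm+1)^{q−1}` of them, and "the AND function cannot be written as an `F`-linear combination of fewer than `(k/(k−1))ⁿ` of the functions `Q_w`" [cite: BarringtonStraubingTherien1990, Theorem 7 (p. 124) and §7 (p. 125)]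
evasions_known: (1) BOTTOM FAN-IN ≥ 2: with an `AND_d` layer of fan-in `d ≥ 2` at the inputs (`MOD_q ∘ MOD_m ∘ AND_d`, polynomials of degree `d` inside the `MOD_m` gates) no lower bound is known in general — this is the Constant Degree Hypothesis of BST90, unresolved "in its general form for over 30 years", proved only for `d = 1`, for symmetric circuits and for restricted wirings [cite: KawalekWeiss2023, pp. 1–4 and Cor. 3] [cite: GrolmuszTardos2000, Degree-Decreasing Lemma (as cited by KawalekWeiss2023 p. 3)]; (2) MORE LEVELS / other groups: over every group not of CDH type `AND_n` has modular circuits (programs) of size `2^{O(n^c)}`, `c < 1` [cite: KawalekWeiss2023, p. 2 (citing Idziak–Kawałek–Krzaczkowski–Weiß, ICALP 2022)], and over any non-nilpotent group exponential-size programs DO compute `AND_n` (the bound is tight in kind) [cite: BarringtonStraubingTherien1990, Theorem 5]; (3) a MAJORITY/threshold output gate instead of `MOD_q` is a different regime (exponential sums, bottom fan-in up to `ε log n`) [cite: Bourgain2005ExpSums, Theorem] [cite: GreenRoyStraubing2005, Theorem]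
scope_caveats: EXACT computation of `AND_n` only — nothing is said about correlation / approximate computation, about targets other than `AND`/`OR` and the non-constant `MOD_r` residue tests with `gcd(m, r) = 1`, `q ∤ r` (symmetric targets with a period `m·q^k` — the subexponential regime of the period theorem — and non-symmetric targets are NOT covered), about prime-power or composite OUTPUT moduli (only `q` prime, `q ∤ m`, is proved here; `m` arbitrary), or about three-level circuits; the advice-free-`QNC⁰` cruxes (`DenseResidualOdd`, `RingDenseResidual3`) are relational/average-case game statements at POLYLOGARITHMIC bottom degree, which sit inside evasion (1) (unresolved in print), NOT inside the theorem — this entry blocks only the degree-`1`, test-oblivious relaxation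
status: established — Theorem 7 and the circuit bound are PROVED in the tree (`Literature.Computability.MetaComplexity.ProductSpan.InSpan.pow_le_card_mul_pow`, `modModCircuit_and_bound`, `modModCircuit_modTest_bound` (via `InSpan.pow_le_card_mul_pow_modPeriodic`), `twoModuliDepthTwo_holds`); the general Constant Degree Hypothesis (bottom fan-in `d ≥ 2`) is a HYPOTHESIS without a printed proof and is deliberately not vendored as a fact [cite: BarringtonStraubingTherien1990, Theorem 7] [cite: KawalekWeiss2023, p. 1] -/
def TwoModuliDepthTwo : Prop :=
  ∀ (m q n : ℕ), q.Prime → ¬ q ∣ m → 0 < m → ∀ C : ModModCircuit m q n, C.ComputesAnd →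
    m ^ n ≤ (C.s * m + 1) ^ (q - 1) * (m - 1) ^ n

/-- **Discharge**: the barrier is a theorem. [cite: BarringtonStraubingTherien1990, Theorem 7 and §7 Proposition] -/
theorem twoModuliDepthTwo_holds : TwoModuliDepthTwo := by
  intro m q n hq hqm hm C hC
  haveI : Fact q.Prime := ⟨hq⟩
  exact modModCircuit_and_bound hm hqm C hC

end Literature.Barriers.QuantumAdvantage
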